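import Mathlib
import HarnessLib

/-!
# Rung S-2 `PersistenceSurface` (stmt-ResolutionOfSingularities-19970), stub C1 (`Sat₄`) on the toric class —
# NUMERATION LEMMA for Hirzebruch–Jung chains, part 1/3: chains, greedy-remainder certificates, the gap source (N2)

Route `ResolutionOfSingularities/HomologicalConductor`, rung S-2 `PersistenceSurface` (stmt-19970), registered stub
`stub_saturationFourSurfaceResidualFour` (`Sat₄` residual), class (iii) «`Sat₄` at non-Gorenstein rational (toric)
stages».  [OURS · cell decomp-res · seat leafhand-res-homologicalconduct-13 gen 0; AI-written, weaker than expert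
review; NOT a statement of the manuscript under review (Hironaka 2017), and no statement of that manuscript is used.]

Pure `ℕ`-combinatorics, def-free.  A HIRZEBRUCH–JUNG CHAIN is carried as explicit data (the representation fixed in
hand census HAND10G2-TORIC-FAMILIES §7): `i b : ℕ → ℕ`, `e`, with `i e = 1`, `i (e+1) = 0`, and for `1 ≤ s ≤ e`
`i (s-1) + i (s+1) = b s * i s`, `2 ≤ b s` (so `i 0 = n > i 1 = q > … > i e = 1`, `n/q = [b 1, …, b e]` as a ceiling
continued fraction — the `i`-series of the cyclic quotient surface singularity `1/n(1,q)`).  The GREEDY REMAINDERS of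
a class `γ` are `τ 0 = γ`, `τ s = τ (s-1) % i s`; the greedy digit at place `t` is `τ (t-1) / i t`, positive iff
`i t ≤ τ (t-1)`.  A CERTIFICATE for `γ` is a sequence `τ'` with `τ' 0 = γ`, `τ' s < i s` and
`τ' (s-1) = τ' s + d_s · i s` (`1 ≤ s ≤ e`); it coincides with the greedy remainders (`eq_of_remainder_certificate`).

This part: elementary chain inequalities (`lt_of_chain`, `diff_antitone_of_chain`, `gap_of_three_le` — a digit
`b u ≥ 3` forces `i a − i (a+1) ≥ i u + 1` for `a < u`), the certificate/uniqueness lemma, and the closed-form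
certificate of HAND10G2 §6 (N1)–(N2) for the class `i 0 − i u` when `3 ≤ b u` or `u ∈ {1, e}`
(`certificate_gap`, `target_gap`): remainders `i s − i (s+1) − i u` below `u`, `i s − i (s+1)` from `u` on, digits
`(b 1 − 1, b 2 − 2, …, b e − 2) − e_u + e_e`.  Parts 2/3 (`…NumerationRuns`, `…Numeration`) treat the sources inside
runs of digits `2` and assemble the numeration lemma «every `i t` is a greedy digit-carrier of some class `n − i u`»
(= Ω-stability of the family `{M_{−i_1}, …, M_{−i_e}}`, the block input (S5) of the `Sat₄` certificate
`…CyclicQuotientIsotypic.cohomologyAnnihilator_eq_four_of_isotypicData`).  No crux, kill test or summit statement is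
proved here.

References: O. Riemenschneider, Math. Ann. 209 (1974); J. Wunram, Math. Ann. 279 (1988) (classical `i`-series
language, not used as premises); HAND10G1-QIV-RETRACT §D/§F, HAND10G2-TORIC-FAMILIES §1/§6/§7 (OURS, cell memos).
-/

-- single-problem summit: the doubled namespace component `ResolutionOfSingularities` is forced
set_option linter.dupNamespace false

namespace Summit.ResolutionOfSingularities.ResolutionOfSingularities.Theorems.HomologicalConductor.PersistenceCyclicQuotientNumeration

/-! ## Hirzebruch–Jung chains: elementary inequalities -/

/-- `2 · i s ≤ i (s-1) + i (s+1)` along the chain (`b s ≥ 2`). [folklore] -/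
theorem two_mul_le_of_chain {e : ℕ} {i b : ℕ → ℕ}
    (hrec : ∀ s, 1 ≤ s → s ≤ e → i (s - 1) + i (s + 1) = b s * i s) (hb : ∀ s, 1 ≤ s → s ≤ e → 2 ≤ b s)
    (s : ℕ) (hs1 : 1 ≤ s) (hse : s ≤ e) : 2 * i s ≤ i (s - 1) + i (s + 1) := by
  rw [hrec s hs1 hse]
  exact Nat.mul_le_mul_right _ (hb s hs1 hse)

/-- The `i`-series is strictly decreasing on `[0, e+1]`: `i (s+1) < i s` for `s ≤ e`. [folklore] -/
theorem lt_of_chain {e : ℕ} {i : ℕ → ℕ} (hie : i e = 1) (hie1 : i (e + 1) = 0)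
    (h2 : ∀ s, 1 ≤ s → s ≤ e → 2 * i s ≤ i (s - 1) + i (s + 1)) :
    ∀ s, s ≤ e → i (s + 1) < i s := by
  -- downward induction: write `s = e - d`
  have key : ∀ d s, s + d = e → i (s + 1) < i s := by
    intro d
    induction d with
    | zero => intro s hs; rw [Nat.add_zero] at hs; subst hs; rw [hie, hie1]; exact Nat.zero_lt_one
    | succ d ih =>
      intro s hs
      have h1 := ih (s + 1) (by omega)
      have h3 := h2 (s + 1) (by omega) (by omega)
      simp only [Nat.add_sub_cancel] at h3
      omega
  intro s hs
  exact key (e - s) s (by omega)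

/-- Antitonicity: `i s' ≤ i s` for `s ≤ s' ≤ e + 1`. [folklore] -/
theorem le_of_chain {e : ℕ} {i : ℕ → ℕ} (hie : i e = 1) (hie1 : i (e + 1) = 0)
    (h2 : ∀ s, 1 ≤ s → s ≤ e → 2 * i s ≤ i (s - 1) + i (s + 1)) :
    ∀ s s', s ≤ s' → s' ≤ e + 1 → i s' ≤ i s := by
  intro s s' hss' hs'
  induction s', hss' using Nat.le_induction with
  | base => exact le_rfl
  | succ s' hs ih => exact (le_of_lt (lt_of_chain hie hie1 h2 s' (by omega))).trans (ih (by omega))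

/-- Positivity: `1 ≤ i s` for `s ≤ e`. [folklore] -/
theorem one_le_of_chain {e : ℕ} {i : ℕ → ℕ} (hie : i e = 1) (hie1 : i (e + 1) = 0)
    (h2 : ∀ s, 1 ≤ s → s ≤ e → 2 * i s ≤ i (s - 1) + i (s + 1)) (s : ℕ) (hs : s ≤ e) : 1 ≤ i s := by
  have := le_of_chain hie hie1 h2 s e hs (by omega)
  omega

/-- The first differences `i a − i (a+1)` are non-increasing in `a` (`b ≥ 2`): for `a ≤ c ≤ e`,
`i c − i (c+1) ≤ i a − i (a+1)`, additively. [folklore] -/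
theorem diff_antitone_of_chain {e : ℕ} {i : ℕ → ℕ}
    (h2 : ∀ s, 1 ≤ s → s ≤ e → 2 * i s ≤ i (s - 1) + i (s + 1)) :
    ∀ a c, a ≤ c → c ≤ e → i c + i (a + 1) ≤ i a + i (c + 1) := by
  intro a c hac hce
  induction c, hac using Nat.le_induction with
  | base => omega
  | succ c hc ih =>
    have h := h2 (c + 1) (by omega) (by omega)
    simp only [Nat.add_sub_cancel] at h
    have := ih (by omega)
    omega

/-- A digit `b u ≥ 3` opens a gap: for every `a < u`, `i (a+1) + i u + 1 ≤ i a` (indeed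
`i a − i (a+1) ≥ i (u-1) − i u ≥ 2 i u − i (u+1) ≥ i u + 1`). [folklore] -/
theorem gap_of_three_le {e : ℕ} {i b : ℕ → ℕ} (hie : i e = 1) (hie1 : i (e + 1) = 0)
    (hrec : ∀ s, 1 ≤ s → s ≤ e → i (s - 1) + i (s + 1) = b s * i s) (hb : ∀ s, 1 ≤ s → s ≤ e → 2 ≤ b s)
    (u : ℕ) (hu1 : 1 ≤ u) (hue : u ≤ e) (hbu : 3 ≤ b u) :
    ∀ a, a + 1 ≤ u → i (a + 1) + i u + 1 ≤ i a := by
  intro a hau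
  have h2 := two_mul_le_of_chain hrec hb
  have hmono := diff_antitone_of_chain h2 a (u - 1) (by omega) (by omega)
  have hu := hrec u hu1 hue
  have h3 : 3 * i u ≤ b u * i u := Nat.mul_le_mul_right _ hbu
  have hlt := lt_of_chain hie hie1 h2 u hue
  have hsub : u - 1 + 1 = u := by omega
  rw [hsub] at hmono
  omega

/-! ## Greedy remainders are determined by a certificate -/

/-- **Uniqueness of greedy remainders.** If `τ` obeys the greedy recursion `τ s = τ (s-1) % i s` on `[1, e]` and
`τ'` is a CERTIFICATE — `τ' s < i s` and `τ' (s-1) = τ' s + d · i s` for some `d`, for every `s ∈ [1, e]` — with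
`τ 0 = τ' 0`, then `τ = τ'` on `[0, e]`. [folklore] -/
theorem eq_of_remainder_certificate (i τ τ' : ℕ → ℕ) (e : ℕ) (h0 : τ 0 = τ' 0)
    (hτ : ∀ s, 1 ≤ s → s ≤ e → τ s = τ (s - 1) % i s)
    (hτ' : ∀ s, 1 ≤ s → s ≤ e → τ' s < i s ∧ ∃ d, τ' (s - 1) = τ' s + d * i s) :
    ∀ s, s ≤ e → τ s = τ' s := by
  intro s hs
  induction s with
  | zero => exact h0
  | succ s ih =>
    have h1 := hτ (s + 1) (by omega) hs
    obtain ⟨hlt, d, hd⟩ := hτ' (s + 1) (by omega) hs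
    simp only [Nat.add_sub_cancel] at h1 hd
    rw [h1, ih (by omega), hd, Nat.add_mul_mod_self_right, Nat.mod_eq_of_lt hlt]

/-- From a certificate one reads the digit: if `τ' (t-1) = τ' t + d · i t` with `1 ≤ d` then `i t ≤ τ' (t-1)`.
[folklore] -/
theorem le_of_digit_pos {τ' i : ℕ → ℕ} {t d : ℕ} (hd : τ' (t - 1) = τ' t + d * i t) (h1 : 1 ≤ d) :
    i t ≤ τ' (t - 1) := by
  rw [hd]
  calc i t = 1 * i t := (Nat.one_mul _).symm
    _ ≤ d * i t := Nat.mul_le_mul_right _ h1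
    _ ≤ τ' t + d * i t := Nat.le_add_left _ _


/-! ## (N2) The gap source: `3 ≤ b u`, or `u = 1`, or `u = e` -/

/-- **Certificate (N2).**  For a source index `u` with `3 ≤ b u` or `u ∈ {1, e}`, the sequence
`τ' 0 = i 0 − i u`, `τ' s = i s − i (s+1) − i u` (`1 ≤ s < u`), `τ' s = i s − i (s+1)` (`u ≤ s < e`), `τ' e = 0`
is a greedy-remainder certificate for the class `i 0 − i u`, with digits `b 1 − 1, b s − 2 (s ∉ {1,u,e}), b u − 3
(1 < u < e), b e − 1 (u ≠ e)` resp. `b 1 − 2` at `s = u = 1 < e`, `b e − 2` at `s = u = e > 1`, `b 1 − 1` at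
`s = u = e = 1`; in particular the digit is `≥ 1` at every `s ≠ u` with `s = 1 ∨ s = e ∨ 3 ≤ b s`, and at `s = u = e`
when `e = 1 ∨ 3 ≤ b e`. (HAND10G2-TORIC-FAMILIES §6 (N1)–(N2).) [folklore] -/
theorem certificate_gap {e : ℕ} {i b τ' : ℕ → ℕ} (hie : i e = 1) (hie1 : i (e + 1) = 0)
    (hrec : ∀ s, 1 ≤ s → s ≤ e → i (s - 1) + i (s + 1) = b s * i s) (hb : ∀ s, 1 ≤ s → s ≤ e → 2 ≤ b s)
    {u : ℕ} (hu1 : 1 ≤ u) (hue : u ≤ e) (hu : 3 ≤ b u ∨ u = 1 ∨ u = e)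
    (h0 : τ' 0 = i 0 - i u) (hA : ∀ s, 1 ≤ s → s < u → τ' s = i s - i (s + 1) - i u)
    (hB : ∀ s, 1 ≤ s → u ≤ s → s < e → τ' s = i s - i (s + 1)) (hE : τ' e = 0) :
    ∀ s, 1 ≤ s → s ≤ e → τ' s < i s ∧ ∃ d, τ' (s - 1) = τ' s + d * i s ∧
      (((s ≠ u ∧ (s = 1 ∨ s = e ∨ 3 ≤ b s)) ∨ (s = u ∧ u = e ∧ (e = 1 ∨ 3 ≤ b e))) → 1 ≤ d) := by
  intro s hs1 hse
  have h2 := two_mul_le_of_chain hrec hb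
  have hrs := hrec s hs1 hse
  have hbs := hb s hs1 hse
  have h2s : 2 * i s ≤ b s * i s := Nat.mul_le_mul_right _ hbs
  have hlt := lt_of_chain hie hie1 h2 s hse
  have hlt' := lt_of_chain hie hie1 h2 (s - 1) (by omega)
  rw [show s - 1 + 1 = s by omega] at hlt'
  have hiu := one_le_of_chain hie hie1 h2 u hue
  have hius : u ≤ s → i s ≤ i u := fun h => le_of_chain hie hie1 h2 u s h (by omega)
  have hpos1 : s < e → 1 ≤ i (s + 1) := fun h => one_le_of_chain hie hie1 h2 (s + 1) (by omega)
  have hs11 : s - 1 + 1 = s := by omega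
  have hgap : 3 ≤ b u → s + 1 ≤ u → i (s + 1) + i u + 1 ≤ i s :=
    fun h3 h => gap_of_three_le hie hie1 hrec hb u hu1 hue h3 s h
  have hgap' : 3 ≤ b u → s ≤ u → i s + i u + 1 ≤ i (s - 1) := fun h3 h => by
    have := gap_of_three_le hie hie1 hrec hb u hu1 hue h3 (s - 1) (by omega)
    rwa [show s - 1 + 1 = s by omega] at this
  have h3u : 3 ≤ b u → 3 * i u ≤ b u * i u := fun h => Nat.mul_le_mul_right _ h
  rcases Nat.lt_or_ge s u with hsu | hsu
  · -- `s < u`: both values of A-form (or `τ' 0` at `s = 1`); here `u ≠ 1`, so `3 ≤ b u` or `u = e`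
    have e1 : τ' s = i s - i (s + 1) - i u := hA s hs1 hsu
    have hex : i (s + 1) + i u ≤ i s := by
      rcases hu with h3 | h1 | he'
      · have := hgap h3 (by omega); omega
      · omega
      · subst he'; have := lt_of_chain hie hie1 h2 s (by omega); omega
    rcases Nat.lt_or_ge 1 s with hs2 | hs2
    · -- `1 < s < u`
      have e0 : τ' (s - 1) = i (s - 1) - i s - i u := by
        have := hA (s - 1) (by omega) (by omega); rwa [hs11] at this
      have hex' : i s + i u ≤ i (s - 1) := by
        rcases hu with h3 | h1 | he'
        · have := hgap' h3 (by omega); omega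
        · omega
        · subst he'; omega
      refine ⟨by omega, b s - 2, ?_, fun _ => by omega⟩
      rw [Nat.sub_mul]; omega
    · -- `s = 1 < u`
      have e0 : τ' (s - 1) = i 0 - i u := by rw [show s - 1 = 0 by omega]; exact h0
      have hi0 : i (s - 1) = i 0 := by rw [show s - 1 = 0 by omega]
      have hiu0 : i u ≤ i 0 := le_of_chain hie hie1 h2 0 u (by omega) (by omega)
      refine ⟨by omega, b s - 1, ?_, fun _ => by omega⟩
      rw [Nat.sub_mul]; omega
  · rcases Nat.lt_or_ge u s with hus | hus
    · -- `u < s`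
      rcases Nat.lt_or_ge s e with hse' | hse'
      · -- `u < s < e`: both B-form
        have e1 : τ' s = i s - i (s + 1) := hB s hs1 (by omega) hse'
        have e0 : τ' (s - 1) = i (s - 1) - i s := by
          have := hB (s - 1) (by omega) (by omega) (by omega); rwa [hs11] at this
        refine ⟨by omega, b s - 2, ?_, fun _ => by omega⟩
        rw [Nat.sub_mul]; omega
      · -- `u < s = e`
        obtain rfl : s = e := le_antisymm hse hse'
        have e1 : τ' s = 0 := hE
        have e0 : τ' (s - 1) = i (s - 1) - i s := by
          have := hB (s - 1) (by omega) (by omega) (by omega); rwa [hs11] at this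
        refine ⟨by omega, b s - 1, ?_, fun _ => by omega⟩
        rw [Nat.sub_mul]; omega
    · -- `s = u`
      obtain rfl : s = u := le_antisymm hus hsu
      rcases Nat.lt_or_ge 1 s with hs2 | hs2
      · -- `1 < s = u`
        have e0 : τ' (s - 1) = i (s - 1) - i s - i s := by
          have := hA (s - 1) (by omega) (by omega); rwa [hs11] at this
        rcases Nat.lt_or_ge s e with hse' | hse'
        · -- `1 < u < e`: digit `b u − 3`
          have h3 : 3 ≤ b s := by rcases hu with h | h | h <;> omega
          have e1 : τ' s = i s - i (s + 1) := hB s hs1 le_rfl hse'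
          have hex' := hgap' h3 le_rfl
          refine ⟨by omega, b s - 3, ?_, fun h => by omega⟩
          rw [Nat.sub_mul]; have := h3u h3; omega
        · -- `1 < u = e`: digit `b e − 2`
          obtain rfl : s = e := le_antisymm hse hse'
          have e1 : τ' s = 0 := hE
          refine ⟨by omega, b s - 2, ?_, fun h => by omega⟩
          rw [Nat.sub_mul]; omega
      · -- `s = u = 1`
        have e0 : τ' (s - 1) = i 0 - i s := by rw [show s - 1 = 0 by omega]; exact h0
        have hi0 : i (s - 1) = i 0 := by rw [show s - 1 = 0 by omega]
        rcases Nat.lt_or_ge s e with hse' | hse'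
        · -- `u = 1 < e`: digit `b 1 − 2`
          have e1 : τ' s = i s - i (s + 1) := hB s hs1 le_rfl hse'
          refine ⟨by omega, b s - 2, ?_, fun h => by omega⟩
          rw [Nat.sub_mul]; omega
        · -- `u = 1 = e`: digit `b 1 − 1`
          obtain rfl : s = e := le_antisymm hse hse'
          have e1 : τ' s = 0 := hE
          have hi2 : i (s + 1) = 0 := hie1
          refine ⟨by omega, b s - 1, ?_, fun _ => by omega⟩
          rw [Nat.sub_mul]; omega


/-- **(N2) for greedy remainders.**  Under the hypotheses of `certificate_gap`, every `τ` with `τ 0 = i 0 − i u`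
obeying the greedy recursion `τ s = τ (s-1) % i s` has `i t ≤ τ (t-1)` (digit `≥ 1`) at every place `t ≠ u`
with `t = 1 ∨ t = e ∨ 3 ≤ b t`, and at `t = u = e` when `e = 1 ∨ 3 ≤ b e`. [folklore] -/
theorem target_gap {e : ℕ} {i b τ' : ℕ → ℕ} (hie : i e = 1) (hie1 : i (e + 1) = 0)
    (hrec : ∀ s, 1 ≤ s → s ≤ e → i (s - 1) + i (s + 1) = b s * i s) (hb : ∀ s, 1 ≤ s → s ≤ e → 2 ≤ b s)
    {u : ℕ} (hu1 : 1 ≤ u) (hue : u ≤ e) (hu : 3 ≤ b u ∨ u = 1 ∨ u = e)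
    (h0 : τ' 0 = i 0 - i u) (hA : ∀ s, 1 ≤ s → s < u → τ' s = i s - i (s + 1) - i u)
    (hB : ∀ s, 1 ≤ s → u ≤ s → s < e → τ' s = i s - i (s + 1)) (hE : τ' e = 0)
    (τ : ℕ → ℕ) (hτ0 : τ 0 = i 0 - i u) (hτ : ∀ s, 1 ≤ s → s ≤ e → τ s = τ (s - 1) % i s)
    (t : ℕ) (ht1 : 1 ≤ t) (hte : t ≤ e)
    (hC : (t ≠ u ∧ (t = 1 ∨ t = e ∨ 3 ≤ b t)) ∨ (t = u ∧ u = e ∧ (e = 1 ∨ 3 ≤ b e))) :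
    i t ≤ τ (t - 1) := by
  have hcert := certificate_gap hie hie1 hrec hb hu1 hue hu h0 hA hB hE
  have heq := eq_of_remainder_certificate i τ τ' e (by rw [hτ0, h0]) hτ
    (fun s hs1 hse => (hcert s hs1 hse).imp_right fun ⟨d, hd, _⟩ => ⟨d, hd⟩)
  obtain ⟨_, d, hd, hdig⟩ := hcert t ht1 hte
  rw [heq (t - 1) (by omega)]
  exact le_of_digit_pos hd (hdig hC)

end Summit.ResolutionOfSingularities.ResolutionOfSingularities.Theorems.HomologicalConductor.PersistenceCyclicQuotientNumeration
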